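import Summits.HubbardSuperconductivity.HubbardSuperconductivity.Theorems.BcsKacWindowInfraredCompletionReduction

/-!
# Crux `InfraredCompletion` (stmt-HubbardSuperconductivity-1321, route BcsKacWindow), line `birth`:
# NECESSITY of the amplitude stub and the point-of-use equivalence

Companion of `BcsKacWindowInfraredCompletionReduction.lean` (the `sorry`-free reduction
`infraredCompletion_of_floor_of_shapeBg : A → B2' → crux` of line `birth`). This file records the
converse bookkeeping, so that the standing of the two physical stubs of the line is exact:

* `pairStructureFactor_zero_le_softWindowSum` — the zero mode lies in every soft window
  `{m : |q_m|² ≤ r²}` and the pair structure factor is termwise nonnegative, so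
  `S_ψ(0) ≤ Σ_{|q_m|² ≤ r²} S_ψ(m)`;
* `softWindowFloor_of_bulk` — for one datum `(a, b, Δ)`, BULK order
  `c₁ Δ(U)² ≤ Re⟨ψ, Δ_d†Δ_d ψ⟩ / L⁴` on all even tori `Δ(U)·L ≥ s₁` (the consequent of the crux)
  gives the soft-window FLOOR of stub A with `c_A = c₁`, `s_A = s₁`, `U_A(t) = U₁`
  (`S_ψ(0) = Re⟨ψ, Δ_d†Δ_d ψ⟩ / L²`, `pairStructureFactor_zero`);
* `stubSoftWindowFloor_of_infraredCompletion` — hence the crux (body verbatim, as in the Reduction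
  file: no import of the route file) IMPLIES the full statement of stub A: the amplitude stub is a
  NECESSARY condition, never stronger than the crux, and promoting it to an item files nothing that
  the route does not already assert;
* `infraredCompletion_iff_floor_of_shapeBg` — given the statement of stub B2' (Goldstone shape with
  background), the crux is EQUIVALENT to stub A. So on line `birth` the phase-coherence stub B2' is
  the only additional bet, and modulo B2' the crux and its amplitude half are the same problem.

No physics is used; `[folklore]` bookkeeping (Kennedy–Lieb–Shastry, PRL 61 (1988) 2582: the zero
mode is one term of the Parseval sum). Lead c14, 2026-08-17.
-/

noncomputable section

-- the mandated namespace `Summit.<Summit>.<Problem>.Theorems…` repeats `HubbardSuperconductivity`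
-- (single-problem summit, D-0017), which the `dupNamespace` linter flags on every declaration
set_option linter.dupNamespace false

namespace Summit.HubbardSuperconductivity.HubbardSuperconductivity.Theorems.InfraredCompletion

open Literature.MathematicalPhysics.QuantumLattice Literature.Probability.LatticeModels
open scoped Matrix

/-- **The zero mode lies below every soft-window sum**: for any vector `ψ` and any radius `r`,
`S_ψ(0) ≤ Σ_{m : |q_m|² ≤ r²} S_ψ(m)` (`0` is in the window since `|q_0|² = 0 ≤ r²`, and every
`S_ψ(m) ≥ 0`). Kennedy–Lieb–Shastry, PRL 61 (1988) 2582. [folklore] -/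
theorem pairStructureFactor_zero_le_softWindowSum {L : ℕ} [NeZero L]
    (ψ : Fock (Orb (FermionTorus 2 L))) (r : ℝ) :
    pairStructureFactor dWaveFormFactor L ψ 0 ≤
      ∑ m ∈ Finset.univ.filter (fun m : Fin 2 → ZMod L => momentumNormSq L m ≤ r ^ 2),
        pairStructureFactor dWaveFormFactor L ψ m := by
  refine Finset.single_le_sum (f := fun m => pairStructureFactor dWaveFormFactor L ψ m)
    (fun m _ => pairStructureFactor_nonneg _ _ _ _) ?_
  rw [Finset.mem_filter, momentumNormSq_zero]
  exact ⟨Finset.mem_univ _, sq_nonneg _⟩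

/-- **Bulk order gives the soft-window floor, one datum** (the converse direction of line `birth`'s
amplitude half). If for the datum `(a, b, Δ)` there are `c₁ > 0`, `s₁`, `U₁ > 0` with
`c₁ Δ(U)² ≤ Re⟨ψ, Δ_d†Δ_d ψ⟩ / L⁴` for all `δ ∈ [a,b]`, `U ∈ (0,U₁)`, even `L` with `s₁ ≤ Δ(U)·L`
and every normalised sector ground state `ψ`, then stub A's floor holds with `c_A = c₁`,
`s_A = s₁` and `U_A(t) = U₁` for every `t ≥ s₁`: on a torus with `t ≤ Δ(U)·L` one has
`s₁ ≤ Δ(U)·L`, so `c₁ Δ² L² ≤ Re⟨Δ_d†Δ_d⟩ / L² = S_ψ(0) ≤ Σ_{|q_m|² ≤ (Δ/t)²} S_ψ(m)`.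
Kennedy–Lieb–Shastry, PRL 61 (1988) 2582. [folklore] -/
theorem softWindowFloor_of_bulk (a b : ℝ) (Δ : ℝ → ℝ)
    (hbulk : ∃ c₁ s₁ U₁ : ℝ, 0 < c₁ ∧ 0 < U₁ ∧ ∀ δ ∈ Set.Icc a b, ∀ U ∈ Set.Ioo (0:ℝ) U₁,
        ∀ (L : ℕ) [NeZero L], Even L → s₁ ≤ Δ U * L →
          ∀ ψ : Fock (Orb (FermionTorus 2 L)), star ψ ⬝ᵥ ψ = 1 →
            IsGroundStateInSector (hubbardTorus 2 L 1 U) (2 * ⌊(1 - δ) * (L : ℝ) ^ 2 / 2⌋₊) 0 ψ →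
              c₁ * Δ U ^ 2 ≤ (expect ((pairField dWaveFormFactor L)ᴴ * pairField dWaveFormFactor L)
                ψ).re / (L : ℝ) ^ 4) :
    ∃ cA sA : ℝ, 0 < cA ∧ ∀ t : ℝ, sA ≤ t → ∃ UA : ℝ, 0 < UA ∧
        ∀ δ ∈ Set.Icc a b, ∀ U ∈ Set.Ioo (0:ℝ) UA, ∀ (L : ℕ) [NeZero L], Even L → t ≤ Δ U * L →
          ∀ ψ : Fock (Orb (FermionTorus 2 L)), star ψ ⬝ᵥ ψ = 1 →
            IsGroundStateInSector (hubbardTorus 2 L 1 U) (2 * ⌊(1 - δ) * (L : ℝ) ^ 2 / 2⌋₊) 0 ψ →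
              cA * Δ U ^ 2 * (L : ℝ) ^ 2 ≤
                ∑ m ∈ Finset.univ.filter
                    (fun m : Fin 2 → ZMod L => momentumNormSq L m ≤ (Δ U / t) ^ 2),
                  pairStructureFactor dWaveFormFactor L ψ m := by
  obtain ⟨c₁, s₁, U₁, hc₁, hU₁, h⟩ := hbulk
  refine ⟨c₁, s₁, hc₁, fun t ht => ⟨U₁, hU₁, ?_⟩⟩
  intro δ hδ U hU L _ hL htL ψ hψ hGS
  have hord := h δ hδ U hU L hL (le_trans ht htL) ψ hψ hGS
  have hL0 : (0 : ℝ) < (L : ℝ) := Nat.cast_pos.2 (Nat.pos_of_ne_zero (NeZero.ne L))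
  have hL2 : (0 : ℝ) < (L : ℝ) ^ 2 := by positivity
  have hL4 : (0 : ℝ) < (L : ℝ) ^ 4 := by positivity
  rw [le_div_iff₀ hL4] at hord
  have hS0 : c₁ * Δ U ^ 2 * (L : ℝ) ^ 2 ≤ pairStructureFactor dWaveFormFactor L ψ 0 := by
    rw [pairStructureFactor_zero dWaveFormFactor L ψ, le_div_iff₀ hL2]
    calc c₁ * Δ U ^ 2 * (L : ℝ) ^ 2 * (L : ℝ) ^ 2 = c₁ * Δ U ^ 2 * (L : ℝ) ^ 4 := by ring
      _ ≤ _ := hord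
  exact le_trans hS0 (pairStructureFactor_zero_le_softWindowSum ψ (Δ U / t))

/-- **Necessity of stub A** (`stub_softWindowFloor` of skeleton
`Cruxes/InfraredCompletion/Lines/birth.lean`): the crux `InfraredCompletion` — body verbatim
(inlined, so that this module does not import the route file) — implies the full statement of the
amplitude stub, datum by datum, by `softWindowFloor_of_bulk`.
So stub A is a necessary condition for the crux and is never stronger than it.
Kennedy–Lieb–Shastry, PRL 61 (1988) 2582. [folklore] -/
theorem stubSoftWindowFloor_of_infraredCompletion :
    (∀ (a b κ₁ κ₂ c₀ s₀ : ℝ) (Δ : ℝ → ℝ), 0 < a → a < b → b < 1 / 2 → 0 < κ₁ → κ₁ ≤ κ₂ → 0 < c₀ →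
      0 < s₀ → (∀ U : ℝ, 0 < U → Real.exp (-(κ₂ / U ^ 2)) ≤ Δ U ∧ Δ U ≤ Real.exp (-(κ₁ / U ^ 2))) →
      (∀ s : ℝ, s₀ ≤ s → ∃ U₁ : ℝ, 0 < U₁ ∧ ∀ δ ∈ Set.Icc a b, ∀ U ∈ Set.Ioo (0:ℝ) U₁,
        ∀ (L : ℕ) [NeZero L], Even L → s₀ ≤ Δ U * L → Δ U * L ≤ s →
          ∀ ψ : Fock (Orb (FermionTorus 2 L)), star ψ ⬝ᵥ ψ = 1 →
            IsGroundStateInSector (hubbardTorus 2 L 1 U) (2 * ⌊(1 - δ) * (L : ℝ) ^ 2 / 2⌋₊) 0 ψ →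
              c₀ * Δ U ^ 2 ≤ (expect ((pairField dWaveFormFactor L)ᴴ * pairField dWaveFormFactor L)
                ψ).re / (L : ℝ) ^ 4) →
      ∃ c₁ s₁ U₁ : ℝ, 0 < c₁ ∧ 0 < U₁ ∧ ∀ δ ∈ Set.Icc a b, ∀ U ∈ Set.Ioo (0:ℝ) U₁,
        ∀ (L : ℕ) [NeZero L], Even L → s₁ ≤ Δ U * L →
          ∀ ψ : Fock (Orb (FermionTorus 2 L)), star ψ ⬝ᵥ ψ = 1 →
            IsGroundStateInSector (hubbardTorus 2 L 1 U) (2 * ⌊(1 - δ) * (L : ℝ) ^ 2 / 2⌋₊) 0 ψ →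
              c₁ * Δ U ^ 2 ≤ (expect ((pairField dWaveFormFactor L)ᴴ * pairField dWaveFormFactor L)
                ψ).re / (L : ℝ) ^ 4) →
    ∀ (a b κ₁ κ₂ c₀ s₀ : ℝ) (Δ : ℝ → ℝ), 0 < a → a < b → b < 1 / 2 → 0 < κ₁ → κ₁ ≤ κ₂ →
      0 < c₀ → 0 < s₀ →
      (∀ U : ℝ, 0 < U → Real.exp (-(κ₂ / U ^ 2)) ≤ Δ U ∧ Δ U ≤ Real.exp (-(κ₁ / U ^ 2))) →
      (∀ s : ℝ, s₀ ≤ s → ∃ U₁ : ℝ, 0 < U₁ ∧ ∀ δ ∈ Set.Icc a b, ∀ U ∈ Set.Ioo (0:ℝ) U₁,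
        ∀ (L : ℕ) [NeZero L], Even L → s₀ ≤ Δ U * L → Δ U * L ≤ s →
          ∀ ψ : Fock (Orb (FermionTorus 2 L)), star ψ ⬝ᵥ ψ = 1 →
            IsGroundStateInSector (hubbardTorus 2 L 1 U) (2 * ⌊(1 - δ) * (L : ℝ) ^ 2 / 2⌋₊) 0 ψ →
              c₀ * Δ U ^ 2 ≤ (expect ((pairField dWaveFormFactor L)ᴴ * pairField dWaveFormFactor L)
                ψ).re / (L : ℝ) ^ 4) →
      ∃ cA sA : ℝ, 0 < cA ∧ ∀ t : ℝ, sA ≤ t → ∃ UA : ℝ, 0 < UA ∧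
        ∀ δ ∈ Set.Icc a b, ∀ U ∈ Set.Ioo (0:ℝ) UA, ∀ (L : ℕ) [NeZero L], Even L → t ≤ Δ U * L →
          ∀ ψ : Fock (Orb (FermionTorus 2 L)), star ψ ⬝ᵥ ψ = 1 →
            IsGroundStateInSector (hubbardTorus 2 L 1 U) (2 * ⌊(1 - δ) * (L : ℝ) ^ 2 / 2⌋₊) 0 ψ →
              cA * Δ U ^ 2 * (L : ℝ) ^ 2 ≤
                ∑ m ∈ Finset.univ.filter
                    (fun m : Fin 2 → ZMod L => momentumNormSq L m ≤ (Δ U / t) ^ 2),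
                  pairStructureFactor dWaveFormFactor L ψ m := by
  intro hI a b κ₁ κ₂ c₀ s₀ Δ ha hab hb hκ₁ hκ₁₂ hc₀ hs₀ hpin hW
  exact softWindowFloor_of_bulk a b Δ (hI a b κ₁ κ₂ c₀ s₀ Δ ha hab hb hκ₁ hκ₁₂ hc₀ hs₀ hpin hW)

/-- **Point-of-use equivalence on line `birth`**: given the statement of the phase-coherence stub
B2' (`stub_goldstoneShapeBg`: Goldstone shape with background on the soft window), the crux
`InfraredCompletion` (body verbatim) is EQUIVALENT to the statement of the amplitude stub A
(`stub_softWindowFloor`): `→` is the landed reduction `infraredCompletion_of_floor_of_shapeBg`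
(floor + shape ⇒ relative tail bound ⇒ zero-mode dominance), `←` is
`stubSoftWindowFloor_of_infraredCompletion` (and does not use B2'). Modulo B2', the window ⇒ bulk
transfer and its amplitude half are the same problem. Kennedy–Lieb–Shastry, PRL 61 (1988) 2582.
[folklore] -/
theorem infraredCompletion_iff_floor_of_shapeBg
    (hB : ∀ (a b κ₁ κ₂ c₀ s₀ : ℝ) (Δ : ℝ → ℝ), 0 < a → a < b → b < 1 / 2 → 0 < κ₁ → κ₁ ≤ κ₂ →
      0 < c₀ → 0 < s₀ →
      (∀ U : ℝ, 0 < U → Real.exp (-(κ₂ / U ^ 2)) ≤ Δ U ∧ Δ U ≤ Real.exp (-(κ₁ / U ^ 2))) →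
      (∀ s : ℝ, s₀ ≤ s → ∃ U₁ : ℝ, 0 < U₁ ∧ ∀ δ ∈ Set.Icc a b, ∀ U ∈ Set.Ioo (0:ℝ) U₁,
        ∀ (L : ℕ) [NeZero L], Even L → s₀ ≤ Δ U * L → Δ U * L ≤ s →
          ∀ ψ : Fock (Orb (FermionTorus 2 L)), star ψ ⬝ᵥ ψ = 1 →
            IsGroundStateInSector (hubbardTorus 2 L 1 U) (2 * ⌊(1 - δ) * (L : ℝ) ^ 2 / 2⌋₊) 0 ψ →
              c₀ * Δ U ^ 2 ≤ (expect ((pairField dWaveFormFactor L)ᴴ * pairField dWaveFormFactor L)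
                ψ).re / (L : ℝ) ^ 4) →
      ∃ A B t₀ UR : ℝ, 0 ≤ A ∧ 0 ≤ B ∧ 0 < t₀ ∧ 0 < UR ∧
        ∀ δ ∈ Set.Icc a b, ∀ U ∈ Set.Ioo (0:ℝ) UR, ∀ (L : ℕ) [NeZero L], Even L → t₀ ≤ Δ U * L →
          ∀ ψ : Fock (Orb (FermionTorus 2 L)), star ψ ⬝ᵥ ψ = 1 →
            IsGroundStateInSector (hubbardTorus 2 L 1 U) (2 * ⌊(1 - δ) * (L : ℝ) ^ 2 / 2⌋₊) 0 ψ →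
              ∀ m : Fin 2 → ZMod L, m ≠ 0 → momentumNormSq L m ≤ (Δ U / t₀) ^ 2 →
                pairStructureFactor dWaveFormFactor L ψ m * Real.sqrt (momentumNormSq L m) *
                    (L : ℝ) ^ 2 ≤
                  A * pairStructureFactor dWaveFormFactor L ψ 0 +
                    B * Real.sqrt (momentumNormSq L m) * (L : ℝ) ^ 2) :
    (∀ (a b κ₁ κ₂ c₀ s₀ : ℝ) (Δ : ℝ → ℝ), 0 < a → a < b → b < 1 / 2 → 0 < κ₁ → κ₁ ≤ κ₂ →
      0 < c₀ → 0 < s₀ →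
      (∀ U : ℝ, 0 < U → Real.exp (-(κ₂ / U ^ 2)) ≤ Δ U ∧ Δ U ≤ Real.exp (-(κ₁ / U ^ 2))) →
      (∀ s : ℝ, s₀ ≤ s → ∃ U₁ : ℝ, 0 < U₁ ∧ ∀ δ ∈ Set.Icc a b, ∀ U ∈ Set.Ioo (0:ℝ) U₁,
        ∀ (L : ℕ) [NeZero L], Even L → s₀ ≤ Δ U * L → Δ U * L ≤ s →
          ∀ ψ : Fock (Orb (FermionTorus 2 L)), star ψ ⬝ᵥ ψ = 1 →
            IsGroundStateInSector (hubbardTorus 2 L 1 U) (2 * ⌊(1 - δ) * (L : ℝ) ^ 2 / 2⌋₊) 0 ψ →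
              c₀ * Δ U ^ 2 ≤ (expect ((pairField dWaveFormFactor L)ᴴ * pairField dWaveFormFactor L)
                ψ).re / (L : ℝ) ^ 4) →
      ∃ cA sA : ℝ, 0 < cA ∧ ∀ t : ℝ, sA ≤ t → ∃ UA : ℝ, 0 < UA ∧
        ∀ δ ∈ Set.Icc a b, ∀ U ∈ Set.Ioo (0:ℝ) UA, ∀ (L : ℕ) [NeZero L], Even L → t ≤ Δ U * L →
          ∀ ψ : Fock (Orb (FermionTorus 2 L)), star ψ ⬝ᵥ ψ = 1 →
            IsGroundStateInSector (hubbardTorus 2 L 1 U) (2 * ⌊(1 - δ) * (L : ℝ) ^ 2 / 2⌋₊) 0 ψ →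
              cA * Δ U ^ 2 * (L : ℝ) ^ 2 ≤
                ∑ m ∈ Finset.univ.filter
                    (fun m : Fin 2 → ZMod L => momentumNormSq L m ≤ (Δ U / t) ^ 2),
                  pairStructureFactor dWaveFormFactor L ψ m) ↔
    (∀ (a b κ₁ κ₂ c₀ s₀ : ℝ) (Δ : ℝ → ℝ), 0 < a → a < b → b < 1 / 2 → 0 < κ₁ → κ₁ ≤ κ₂ → 0 < c₀ →
      0 < s₀ → (∀ U : ℝ, 0 < U → Real.exp (-(κ₂ / U ^ 2)) ≤ Δ U ∧ Δ U ≤ Real.exp (-(κ₁ / U ^ 2))) →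
      (∀ s : ℝ, s₀ ≤ s → ∃ U₁ : ℝ, 0 < U₁ ∧ ∀ δ ∈ Set.Icc a b, ∀ U ∈ Set.Ioo (0:ℝ) U₁,
        ∀ (L : ℕ) [NeZero L], Even L → s₀ ≤ Δ U * L → Δ U * L ≤ s →
          ∀ ψ : Fock (Orb (FermionTorus 2 L)), star ψ ⬝ᵥ ψ = 1 →
            IsGroundStateInSector (hubbardTorus 2 L 1 U) (2 * ⌊(1 - δ) * (L : ℝ) ^ 2 / 2⌋₊) 0 ψ →
              c₀ * Δ U ^ 2 ≤ (expect ((pairField dWaveFormFactor L)ᴴ * pairField dWaveFormFactor L)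
                ψ).re / (L : ℝ) ^ 4) →
      ∃ c₁ s₁ U₁ : ℝ, 0 < c₁ ∧ 0 < U₁ ∧ ∀ δ ∈ Set.Icc a b, ∀ U ∈ Set.Ioo (0:ℝ) U₁,
        ∀ (L : ℕ) [NeZero L], Even L → s₁ ≤ Δ U * L →
          ∀ ψ : Fock (Orb (FermionTorus 2 L)), star ψ ⬝ᵥ ψ = 1 →
            IsGroundStateInSector (hubbardTorus 2 L 1 U) (2 * ⌊(1 - δ) * (L : ℝ) ^ 2 / 2⌋₊) 0 ψ →
              c₁ * Δ U ^ 2 ≤ (expect ((pairField dWaveFormFactor L)ᴴ * pairField dWaveFormFactor L)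
                ψ).re / (L : ℝ) ^ 4) :=
  ⟨fun hA => infraredCompletion_of_floor_of_shapeBg hA hB,
    fun hI => stubSoftWindowFloor_of_infraredCompletion hI⟩

end Summit.HubbardSuperconductivity.HubbardSuperconductivity.Theorems.InfraredCompletion

end
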